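import Literature.Analysis.Asymptotics.LaplaceSupNormLimit
import Mathlib.MeasureTheory.Integral.Prod
import Mathlib.MeasureTheory.Measure.Lebesgue.Basic
import Mathlib.Analysis.SpecialFunctions.Integrability.Basic
import HarnessLib

/-!
# The Viola–Zudilin double integrals `J_z^{(0)}(hn, jn, kn, ln, mn, qn)`: vocabulary and rate

Topic `Literature/NumberTheory/DiophantineApproximation`. Definitions, proved API, and the existence of the
exponential rate of `J_z^{(0)}` by the elementary Laplace method; no named facts. Source: C. Viola, W. Zudilin,
*Linear independence of dilogarithmic values*, J. reine angew. Math. 736 (2018), §2.1 and §4.1 — the real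
member of the family of double integrals behind the named fact `ViolaZudilin2018_dilogLandenLinearIndependent`
(`DilogLandenLinearIndependence.lean`, reduced to the forms in `DilogLandenLinearIndependenceProofs.lean`).
For integer parameters `π = (h, j, k, l, m, q) ≥ 0` (§2.1, with `j+k−m, j+q−m, h+m−k, h+q−k ≥ 0`) and `z > 1`,
`J_z^{(0)}(h,…,q) = z^{k−l−q} ∫₀¹∫₀¹ x^j(1−x)^h y^k(1−y)^l (1−y+yz)^{j+q−m} dx dy / (x(1−y)+yz)^{j+k−m+1}` (the factor
`(1−y+yz)^{j+q−m} = (1+y(z−1))^{j+q−m}` is the one expanded by the binomial theorem in the proof of Lemma 2.1),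
used with all parameters multiplied by `n → ∞`; by (4.12),
`J_z^{(0)}(hn,…,qn) = z^{(k−l−q)n} ∫₀¹∫₀¹ g_z(x,y)ⁿ dx dy/(x(1−y)+yz)`,
`g_z = x^j(1−x)^h y^k(1−y)^l (1−y+yz)^{j+q−m}/(x(1−y)+yz)^{j+k−m}` ("Inside the unit square the integrand is
positive with one stationary point, and vanishes on the boundary. Then the desired `lim (1/n) log J_z^{(0)}` is
obtained by Laplace's elementary asymptotic method"). Here `base z π = g_z`, `weight z = 1/(x(1−y)+yz)`,
`J0 z π n = z^{(k−l−q)n} ∫_{[0,1]²} (base z π)ⁿ · weight z`, and `exists_tendsto_log_J0_div` is that limit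
(its value, `log max g_z + (k−l−q) log z`, is not certified here; numerically `−log max g_z` reproduces the
paper's `c₀`: `95.808510` for `z = 9`, `(37,37,22,14,23,8)`, maximum at `(x,y) ≈ (0.4761, 0.3386)`, i.e.
`(ξ₀, η₀) = (0.4761…, −4.6067…)` of (4.20) under `x = ξ`, `y = η/(η−z)`; `102.823` for `z = 10`; `69.183` for
`z = 11`; `27.625757` for `z = 24`, `(9,9,5,4,5,1)` — Table 1 and §6.2).

Design notes. The exponents `j+k−m`, `j+q−m` are natural-number subtractions — the printed ones under
`m ≤ j+k`, `m ≤ j+q` (true for every parameter set of the paper, Table 1); the prefactor is an integer power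
(`zpow`; equal to `1` in Table 1, where `k = l + q`). At the corner `(0,0)` the first denominator vanishes:
`base = 0/0 = 0` IS the continuous extension when `1 ≤ m ≤ j+k` (`continuousOn_base`), and `weight = 1/0 = 0`
is a junk value at one point (the weight is integrable, `integrableOn_weight`). The mixed and contour integrals
`J^{(1)}, J^{(2)}, K^{(0)}` of the paper are NOT defined here.

## References

* C. Viola, W. Zudilin, J. reine angew. Math. 736 (2018) 193–223, §2.1 (`J_z^{(0)}`), §4.1 (4.12), Prop. 4.1.
  [ViolaZudilin2018]
-/

noncomputable section

namespace Literature.NumberTheory.DiophantineApproximation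

namespace ViolaZudilin

open MeasureTheory Set

/-- The six parameters `(h, j, k, l, m, q) ≥ 0` of the Viola–Zudilin integrals. [cite: ViolaZudilin2018, §2.1] -/
structure Params where
  /-- the exponent `h` of `(1 − x)` -/
  h : ℕ
  /-- the exponent `j` of `x` -/
  j : ℕ
  /-- the exponent `k` of `y` -/
  k : ℕ
  /-- the exponent `l` of `(1 − y)` -/
  l : ℕ
  /-- the parameter `m` (the denominator `x(1−y)+yz` has exponent `j + k − m`, plus one) -/
  m : ℕ
  /-- the parameter `q` (the factor `1−y+yz` has exponent `j + q − m`) -/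
  q : ℕ

/-- The closed unit square `[0,1]²`, the domain of integration of `J_z^{(0)}`. [cite: ViolaZudilin2018, §2.1] -/
def unitSquare : Set (ℝ × ℝ) := Icc (0 : ℝ) 1 ×ˢ Icc (0 : ℝ) 1

/-- The denominator `x(1−y) + yz` (zero on the square only at the corner `(0,0)`). [cite: ViolaZudilin2018, §2.1] -/
def denom₁ (z : ℝ) (p : ℝ × ℝ) : ℝ := p.1 * (1 - p.2) + p.2 * z

/-- The factor `1 − y + yz` (between `1` and `z` on the square when `z ≥ 1`; its power `j+q−m` is the one
expanded by the binomial theorem in the proof of Lemma 2.1). [cite: ViolaZudilin2018, §2.1] -/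
def denom₂ (z : ℝ) (p : ℝ × ℝ) : ℝ := 1 - p.2 + p.2 * z

/-- The base `g_z(x,y) = x^j (1−x)^h y^k (1−y)^l (1−y+yz)^{j+q−m} / (x(1−y)+yz)^{j+k−m}` of the `n`-th power in
`J_z^{(0)}(hn,…,qn)` (Viola–Zudilin (4.12); it is `|f_z(ξ,η)|·z^{l+q−k}` of (4.1) in the coordinates `x = ξ`,
`y = η/(η−z)`); natural-number exponents `j+k−m`, `j+q−m` (the printed ones when `m ≤ j+k`, `m ≤ j+q`); value `0`
at the corner `(0,0)`. [cite: ViolaZudilin2018, §4.1 (4.1), (4.12)] -/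
def base (z : ℝ) (π : Params) (p : ℝ × ℝ) : ℝ :=
  p.1 ^ π.j * (1 - p.1) ^ π.h * p.2 ^ π.k * (1 - p.2) ^ π.l * denom₂ z p ^ (π.j + π.q - π.m) /
    denom₁ z p ^ (π.j + π.k - π.m)

/-- The weight `1/(x(1−y)+yz)` of (4.12) (junk value `0` at the corner). [cite: ViolaZudilin2018, §4.1 (4.12)] -/
def weight (z : ℝ) (p : ℝ × ℝ) : ℝ := 1 / denom₁ z p

/-- **`J_z^{(0)}(hn, jn, kn, ln, mn, qn)`** in the form (4.12) of Viola–Zudilin: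
`z^{(k−l−q)n} ∫_{[0,1]²} g_z(x,y)ⁿ dx dy / (x(1−y)+yz)`. [cite: ViolaZudilin2018, §2.1 and §4.1 (4.12)] -/
def J0 (z : ℝ) (π : Params) (n : ℕ) : ℝ :=
  z ^ (((π.k : ℤ) - π.l - π.q) * n) * ∫ p in unitSquare, base z π p ^ n * weight z p

/-! ### Elementary API -/
/-- Membership in the unit square, coordinatewise. [folklore] -/
theorem mem_unitSquare {p : ℝ × ℝ} :
    p ∈ unitSquare ↔ (0 ≤ p.1 ∧ p.1 ≤ 1) ∧ (0 ≤ p.2 ∧ p.2 ≤ 1) := by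
  simp only [unitSquare, Set.mem_prod, Set.mem_Icc]
/-- On the square, `x ≤ x(1−y) + yz` when `z ≥ 1` (`D₁ − x = y(z − x) ≥ 0`). [folklore] -/
theorem fst_le_denom₁ {z : ℝ} (hz : 1 ≤ z) {p : ℝ × ℝ} (hp : p ∈ unitSquare) : p.1 ≤ denom₁ z p := by
  obtain ⟨⟨hx0, hx1⟩, hy0, hy1⟩ := mem_unitSquare.1 hp
  rw [denom₁]
  nlinarith [mul_nonneg hy0 (show 0 ≤ z - p.1 by linarith)]
/-- On the square, `y ≤ x(1−y) + yz` when `z ≥ 1` (`D₁ − y = x(1−y) + y(z−1) ≥ 0`). [folklore] -/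
theorem snd_le_denom₁ {z : ℝ} (hz : 1 ≤ z) {p : ℝ × ℝ} (hp : p ∈ unitSquare) : p.2 ≤ denom₁ z p := by
  obtain ⟨⟨hx0, hx1⟩, hy0, hy1⟩ := mem_unitSquare.1 hp
  rw [denom₁]
  nlinarith [mul_nonneg hx0 (show 0 ≤ 1 - p.2 by linarith), mul_nonneg hy0 (show 0 ≤ z - 1 by linarith)]

/-- On the square, `max(x, y) ≤ x(1−y) + yz` when `z ≥ 1` (so the denominator vanishes only at the corner).
[folklore] -/
theorem max_le_denom₁ {z : ℝ} (hz : 1 ≤ z) {p : ℝ × ℝ} (hp : p ∈ unitSquare) :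
    max p.1 p.2 ≤ denom₁ z p :=
  max_le (fst_le_denom₁ hz hp) (snd_le_denom₁ hz hp)
/-- On the square, `1 ≤ 1 − y + yz` when `z ≥ 1`. [folklore] -/
theorem one_le_denom₂ {z : ℝ} (hz : 1 ≤ z) {p : ℝ × ℝ} (hp : p ∈ unitSquare) : 1 ≤ denom₂ z p := by
  obtain ⟨-, hy0, -⟩ := mem_unitSquare.1 hp
  rw [denom₂]
  nlinarith [mul_nonneg hy0 (show 0 ≤ z - 1 by linarith)]
/-- On the square, `1 − y + yz ≤ z` when `z ≥ 1`. [folklore] -/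
theorem denom₂_le {z : ℝ} (hz : 1 ≤ z) {p : ℝ × ℝ} (hp : p ∈ unitSquare) : denom₂ z p ≤ z := by
  obtain ⟨-, -, hy1⟩ := mem_unitSquare.1 hp
  rw [denom₂]
  nlinarith [mul_nonneg (show 0 ≤ 1 - p.2 by linarith) (show 0 ≤ z - 1 by linarith)]
/-- The base `g_z` is non-negative on the square (`z ≥ 1`). [folklore] -/
theorem base_nonneg {z : ℝ} (hz : 1 ≤ z) (π : Params) {p : ℝ × ℝ} (hp : p ∈ unitSquare) :
    0 ≤ base z π p := by
  obtain ⟨⟨hx0, hx1⟩, hy0, hy1⟩ := mem_unitSquare.1 hp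
  have hD₁ : 0 ≤ denom₁ z p := hx0.trans (fst_le_denom₁ hz hp)
  have hD₂ : 0 ≤ denom₂ z p := zero_le_one.trans (one_le_denom₂ hz hp)
  unfold base
  apply div_nonneg
  · apply_rules [mul_nonneg, pow_nonneg] <;> linarith
  · exact pow_nonneg hD₁ _

/-- The weight `1/(x(1−y)+yz)` is non-negative on the square (`z ≥ 1`). [folklore] -/
theorem weight_nonneg {z : ℝ} (hz : 1 ≤ z) {p : ℝ × ℝ} (hp : p ∈ unitSquare) : 0 ≤ weight z p := by
  obtain ⟨⟨hx0, -⟩, -⟩ := mem_unitSquare.1 hp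
  exact div_nonneg zero_le_one (hx0.trans (fst_le_denom₁ hz hp))

/-! ### The elementary Laplace method for `J_z^{(0)}`: existence of the rate `c₀` -/

open _root_.Filter _root_.Topology

/-- The unit square is compact. [folklore] -/
theorem isCompact_unitSquare : IsCompact unitSquare := isCompact_Icc.prod isCompact_Icc
/-- The unit square is measurable. [folklore] -/
theorem measurableSet_unitSquare : MeasurableSet unitSquare := measurableSet_Icc.prod measurableSet_Icc

/-- The open square lies in the interior of the closed one. [folklore] -/
theorem Ioo_prod_subset_interior_unitSquare : Ioo (0 : ℝ) 1 ×ˢ Ioo (0 : ℝ) 1 ⊆ interior unitSquare := by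
  rw [unitSquare, interior_prod_eq, interior_Icc]
/-- The open square lies in the closed one. [folklore] -/
theorem Ioo_prod_subset_unitSquare : Ioo (0 : ℝ) 1 ×ˢ Ioo (0 : ℝ) 1 ⊆ unitSquare :=
  prod_mono Ioo_subset_Icc_self Ioo_subset_Icc_self

/-- The first denominator is continuous. [folklore] -/
theorem continuous_denom₁ (z : ℝ) : Continuous (denom₁ z) := by unfold denom₁; fun_prop
/-- The second denominator is continuous. [folklore] -/
theorem continuous_denom₂ (z : ℝ) : Continuous (denom₂ z) := by unfold denom₂; fun_prop

/-- The numerator `x^j(1−x)^h y^k(1−y)^l` is continuous. [folklore] -/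
theorem continuous_numer (π : Params) :
    Continuous fun p : ℝ × ℝ => p.1 ^ π.j * (1 - p.1) ^ π.h * p.2 ^ π.k * (1 - p.2) ^ π.l := by fun_prop

/-- **The corner bound** `g_z(x,y) ≤ z^{j+q−m} max(x,y)^m` on the square (`z ≥ 1`, `1 ≤ m ≤ j+k`): the numerator
is `≤ max^{j+k} z^{j+q−m}` (`1−y+yz ≤ z`), the denominator `≥ max^{j+k−m}` (`max(x,y) ≤ x(1−y)+yz`). [folklore] -/
theorem base_le_max_pow {z : ℝ} (hz : 1 ≤ z) (π : Params) (hm1 : 1 ≤ π.m) (hm : π.m ≤ π.j + π.k)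
    {p : ℝ × ℝ} (hp : p ∈ unitSquare) :
    base z π p ≤ z ^ (π.j + π.q - π.m) * (max p.1 p.2) ^ π.m := by
  obtain ⟨⟨hx0, hx1⟩, hy0, hy1⟩ := mem_unitSquare.1 hp
  set M := max p.1 p.2 with hM
  have hz0 : 0 ≤ z := zero_le_one.trans hz
  have hM0 : 0 ≤ M := le_max_of_le_left hx0
  have hxM : p.1 ≤ M := le_max_left _ _
  have hyM : p.2 ≤ M := le_max_right _ _
  have hD₁ : M ≤ denom₁ z p := max_le_denom₁ hz hp
  have hD₁0 : 0 ≤ denom₁ z p := hM0.trans hD₁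
  have hD₂ : 0 ≤ denom₂ z p := zero_le_one.trans (one_le_denom₂ hz hp)
  have hD₂z : denom₂ z p ≤ z := denom₂_le hz hp
  -- numerator ≤ M^(j+k) z^(j+q-m)
  have hN : p.1 ^ π.j * (1 - p.1) ^ π.h * p.2 ^ π.k * (1 - p.2) ^ π.l * denom₂ z p ^ (π.j + π.q - π.m)
      ≤ M ^ (π.j + π.k) * z ^ (π.j + π.q - π.m) := by
    calc p.1 ^ π.j * (1 - p.1) ^ π.h * p.2 ^ π.k * (1 - p.2) ^ π.l * denom₂ z p ^ (π.j + π.q - π.m)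
        ≤ M ^ π.j * 1 ^ π.h * M ^ π.k * 1 ^ π.l * z ^ (π.j + π.q - π.m) := by
          gcongr <;> linarith
      _ = M ^ (π.j + π.k) * z ^ (π.j + π.q - π.m) := by rw [one_pow, one_pow, mul_one, mul_one, pow_add]
  rcases eq_or_lt_of_le hM0 with hM00 | hMpos
  · -- corner: `M = 0`, numerator `0`
    have hx : p.1 = 0 := le_antisymm (hxM.trans hM00.symm.le) hx0
    have hy : p.2 = 0 := le_antisymm (hyM.trans hM00.symm.le) hy0
    have hnum : p.1 ^ π.j * (1 - p.1) ^ π.h * p.2 ^ π.k * (1 - p.2) ^ π.l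
        * denom₂ z p ^ (π.j + π.q - π.m) = 0 := by
      have hjk : π.j ≠ 0 ∨ π.k ≠ 0 := by omega
      rcases hjk with hj | hk
      · rw [hx, zero_pow hj]; ring
      · rw [hy, zero_pow hk]; ring
    rw [base, hnum, zero_div, ← hM00, zero_pow (by omega), mul_zero]
  · -- `M > 0`
    have hE : M ^ (π.j + π.k - π.m) ≤ denom₁ z p ^ (π.j + π.k - π.m) := pow_le_pow_left₀ hM0 hD₁ _
    have hEpos : 0 < M ^ (π.j + π.k - π.m) := pow_pos hMpos _
    calc base z π p ≤ M ^ (π.j + π.k) * z ^ (π.j + π.q - π.m) / denom₁ z p ^ (π.j + π.k - π.m) :=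
          div_le_div_of_nonneg_right hN (hEpos.le.trans hE)
      _ ≤ M ^ (π.j + π.k) * z ^ (π.j + π.q - π.m) / M ^ (π.j + π.k - π.m) :=
          div_le_div_of_nonneg_left (mul_nonneg (pow_nonneg hM0 _) (pow_nonneg hz0 _)) hEpos hE
      _ = z ^ (π.j + π.q - π.m) * M ^ π.m := by
          have hsplit : M ^ (π.j + π.k) = M ^ (π.j + π.k - π.m) * M ^ π.m := by
            rw [← pow_add]; congr 1; omega
          rw [hsplit]
          field_simp

/-- **`g_z` is continuous on the closed square** for `z ≥ 1`, `1 ≤ m ≤ j+k` (at the corner `(0,0)`, where the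
first denominator vanishes, by the corner bound; elsewhere the denominators are non-zero).
[cite: ViolaZudilin2018, §4.1 (4.12)] -/
theorem continuousOn_base {z : ℝ} (hz : 1 ≤ z) (π : Params) (hm1 : 1 ≤ π.m) (hm : π.m ≤ π.j + π.k) :
    ContinuousOn (base z π) unitSquare := by
  intro p₀ hp₀
  obtain ⟨⟨hx0, hx1⟩, hy0, hy1⟩ := mem_unitSquare.1 hp₀
  by_cases hcorner : max p₀.1 p₀.2 = 0
  · -- the corner `(0,0)`: squeeze `0 ≤ base ≤ max(x,y)^m`
    have hval : base z π p₀ = 0 := by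
      refine le_antisymm ?_ (base_nonneg hz π hp₀)
      have h := base_le_max_pow hz π hm1 hm hp₀
      rwa [hcorner, zero_pow (by omega), mul_zero] at h
    have hup : Tendsto (fun p : ℝ × ℝ => z ^ (π.j + π.q - π.m) * (max p.1 p.2) ^ π.m)
        (𝓝[unitSquare] p₀) (𝓝 0) := by
      have hc : Continuous fun p : ℝ × ℝ => z ^ (π.j + π.q - π.m) * (max p.1 p.2) ^ π.m := by fun_prop
      have h := hc.continuousAt.tendsto (x := p₀)
      rw [hcorner, zero_pow (by omega), mul_zero] at h
      exact h.mono_left nhdsWithin_le_nhds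
    rw [ContinuousWithinAt, hval]
    refine tendsto_of_tendsto_of_tendsto_of_le_of_le' tendsto_const_nhds hup ?_ ?_
    · filter_upwards [self_mem_nhdsWithin] with p hp using base_nonneg hz π hp
    · filter_upwards [self_mem_nhdsWithin] with p hp using base_le_max_pow hz π hm1 hm hp
  · -- away from the corner the denominators do not vanish
    have hMpos : 0 < max p₀.1 p₀.2 := lt_of_le_of_ne (le_max_of_le_left hx0) (Ne.symm hcorner)
    have hD₁ : 0 < denom₁ z p₀ := hMpos.trans_le (max_le_denom₁ hz hp₀)
    have hE : denom₁ z p₀ ^ (π.j + π.k - π.m) ≠ 0 := pow_ne_zero _ hD₁.ne'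
    have hcont : ContinuousAt (base z π) p₀ := by
      have hNc : Continuous fun p : ℝ × ℝ => p.1 ^ π.j * (1 - p.1) ^ π.h * p.2 ^ π.k * (1 - p.2) ^ π.l
          * denom₂ z p ^ (π.j + π.q - π.m) := (continuous_numer π).mul ((continuous_denom₂ z).pow _)
      exact hNc.continuousAt.div ((continuous_denom₁ z).pow _).continuousAt hE
    exact hcont.continuousWithinAt

/-- `g_z > 0` on the open square (`z ≥ 1`): "Inside the unit square the integrand is positive".
[cite: ViolaZudilin2018, §4.1 (4.12)] -/
theorem base_pos {z : ℝ} (hz : 1 ≤ z) (π : Params) {p : ℝ × ℝ} (hp : p ∈ Ioo (0 : ℝ) 1 ×ˢ Ioo (0 : ℝ) 1) :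
    0 < base z π p := by
  obtain ⟨⟨hx0, hx1⟩, hy0, hy1⟩ := hp
  have hp' : p ∈ unitSquare := Ioo_prod_subset_unitSquare ⟨⟨hx0, hx1⟩, hy0, hy1⟩
  have hD₁ : 0 < denom₁ z p := hx0.trans_le (fst_le_denom₁ hz hp')
  have hD₂ : 0 < denom₂ z p := zero_lt_one.trans_le (one_le_denom₂ hz hp')
  unfold base
  apply div_pos
  · have h1 : 0 < 1 - p.1 := by linarith
    have h2 : 0 < 1 - p.2 := by linarith
    positivity
  · positivity

/-- `g_z` vanishes on the boundary of the square when `h, j, k, l ≥ 1`: "and vanishes on the boundary".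
[cite: ViolaZudilin2018, §4.1 (4.12)] -/
theorem base_eq_zero_of_boundary (z : ℝ) (π : Params) (hh : 1 ≤ π.h) (hj : 1 ≤ π.j) (hk : 1 ≤ π.k)
    (hl : 1 ≤ π.l) {p : ℝ × ℝ} (hp : p.1 = 0 ∨ p.1 = 1 ∨ p.2 = 0 ∨ p.2 = 1) : base z π p = 0 := by
  unfold base
  rcases hp with h | h | h | h <;>
    simp [h, Nat.pos_iff_ne_zero.1 hh, Nat.pos_iff_ne_zero.1 hj, Nat.pos_iff_ne_zero.1 hk, Nat.pos_iff_ne_zero.1 hl]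

/-- Lebesgue measure on the square is the product of the two interval measures. [folklore] -/
theorem volume_restrict_unitSquare :
    (volume : Measure (ℝ × ℝ)).restrict unitSquare =
      ((volume : Measure ℝ).restrict (Icc 0 1)).prod ((volume : Measure ℝ).restrict (Icc 0 1)) := by
  rw [unitSquare, Measure.volume_eq_prod, Measure.prod_restrict]

/-- The coordinate axes are Lebesgue-null in the plane. [folklore] -/
theorem ae_fst_ne_zero_and_snd_ne_zero :
    ∀ᵐ p : ℝ × ℝ ∂volume, p.1 ≠ 0 ∧ p.2 ≠ 0 := by
  have h1 : (volume : Measure (ℝ × ℝ)) {p | p.1 = 0} = 0 := by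
    have : {p : ℝ × ℝ | p.1 = 0} = ({0} : Set ℝ) ×ˢ (univ : Set ℝ) := by
      ext p; simp [Set.mem_prod]
    rw [this, Measure.volume_eq_prod, Measure.prod_prod, Real.volume_singleton, zero_mul]
  have h2 : (volume : Measure (ℝ × ℝ)) {p | p.2 = 0} = 0 := by
    have : {p : ℝ × ℝ | p.2 = 0} = (univ : Set ℝ) ×ˢ ({0} : Set ℝ) := by
      ext p; simp [Set.mem_prod]
    rw [this, Measure.volume_eq_prod, Measure.prod_prod, Real.volume_singleton, mul_zero]
  filter_upwards [measure_eq_zero_iff_ae_notMem.1 h1, measure_eq_zero_iff_ae_notMem.1 h2] with p h h' using ⟨h, h'⟩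

/-- **The weight `1/(x(1−y)+yz)` is integrable on the square** (`z ≥ 1`): it is dominated off the axes by
`x^{−1/2} y^{−1/2}` (`x(1−y)+yz ≥ max(x,y) ≥ √(xy)`), a product of integrable functions. [folklore] -/
theorem integrableOn_weight {z : ℝ} (hz : 1 ≤ z) : IntegrableOn (weight z) unitSquare volume := by
  -- the majorant `x^{-1/2} y^{-1/2}`
  have hI1 : IntegrableOn (fun x : ℝ => x ^ (-(1 / 2 : ℝ))) (Icc 0 1) volume :=
    (intervalIntegrable_iff_integrableOn_Icc_of_le zero_le_one).1
      (intervalIntegral.intervalIntegrable_rpow' (by norm_num))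
  have hF : IntegrableOn (fun p : ℝ × ℝ => p.1 ^ (-(1 / 2 : ℝ)) * p.2 ^ (-(1 / 2 : ℝ))) unitSquare volume := by
    rw [IntegrableOn, volume_restrict_unitSquare]
    exact hI1.mul_prod hI1
  have hmeas : AEStronglyMeasurable (weight z) (volume.restrict unitSquare) := by
    have : Measurable (weight z) := measurable_const.div (continuous_denom₁ z).measurable
    exact this.aestronglyMeasurable
  refine Integrable.mono' hF hmeas ?_
  filter_upwards [ae_restrict_mem measurableSet_unitSquare,
    ae_restrict_of_ae (s := unitSquare) ae_fst_ne_zero_and_snd_ne_zero] with p hp hne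
  obtain ⟨⟨hx0, hx1⟩, hy0, hy1⟩ := mem_unitSquare.1 hp
  have hx : 0 < p.1 := lt_of_le_of_ne hx0 (Ne.symm hne.1)
  have hy : 0 < p.2 := lt_of_le_of_ne hy0 (Ne.symm hne.2)
  have hxy : 0 < p.1 * p.2 := mul_pos hx hy
  have hD₁ : Real.sqrt (p.1 * p.2) ≤ denom₁ z p := by
    refine le_trans ?_ (max_le_denom₁ hz hp)
    have hM0 : 0 ≤ max p.1 p.2 := le_max_of_le_left hx0
    calc Real.sqrt (p.1 * p.2) ≤ Real.sqrt (max p.1 p.2 * max p.1 p.2) :=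
          Real.sqrt_le_sqrt (mul_le_mul (le_max_left _ _) (le_max_right _ _) hy0 hM0)
      _ = max p.1 p.2 := Real.sqrt_mul_self hM0
  have hsqrt : 0 < Real.sqrt (p.1 * p.2) := Real.sqrt_pos.2 hxy
  have hD₁pos : 0 < denom₁ z p := hsqrt.trans_le hD₁
  rw [Real.norm_eq_abs, weight, abs_of_pos (one_div_pos.2 hD₁pos)]
  calc 1 / denom₁ z p ≤ 1 / Real.sqrt (p.1 * p.2) := one_div_le_one_div_of_le hsqrt hD₁
    _ = (p.1 * p.2) ^ (-(1 / 2 : ℝ)) := by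
        rw [Real.sqrt_eq_rpow, Real.rpow_neg hxy.le, one_div]
    _ = p.1 ^ (-(1 / 2 : ℝ)) * p.2 ^ (-(1 / 2 : ℝ)) := Real.mul_rpow hx0 hy0

/-- **Existence of the rate of `J_z^{(0)}`** (Viola–Zudilin, first line of Prop. 4.1 / (4.12), qualitatively):
for `z ≥ 1` and parameters with `h, j, k, l ≥ 1`, `1 ≤ m ≤ j + k`, the base `g_z` attains its maximum on the
square at an interior point `p₀`, `g_z(p₀) > 0`, and
`(1/n) log ∫_{[0,1]²} g_zⁿ/(x(1−y)+yz) → log g_z(p₀) = log max g_z` (the elementary Laplace method,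
`Literature.Analysis.Asymptotics.tendsto_log_setIntegral_pow_mul_div_of_integrableOn`). The paper's
`c₀ = −log |f_z(ξ₀, η₀)|` is `−log g_z(p₀)` (the stationary point in the original coordinates).
[cite: ViolaZudilin2018, §4.1 (4.12) and Prop. 4.1] -/
theorem exists_isMaxOn_tendsto_log_integral_div {z : ℝ} (hz : 1 ≤ z) (π : Params) (hh : 1 ≤ π.h)
    (hj : 1 ≤ π.j) (hk : 1 ≤ π.k) (hl : 1 ≤ π.l) (hm1 : 1 ≤ π.m) (hm : π.m ≤ π.j + π.k) :
    ∃ p₀ ∈ Ioo (0 : ℝ) 1 ×ˢ Ioo (0 : ℝ) 1, IsMaxOn (base z π) unitSquare p₀ ∧ 0 < base z π p₀ ∧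
      Tendsto (fun n : ℕ => Real.log (∫ p in unitSquare, base z π p ^ n * weight z p) / n) atTop
        (𝓝 (Real.log (base z π p₀))) := by
  have hhalf : ((1 / 2 : ℝ), (1 / 2 : ℝ)) ∈ Ioo (0 : ℝ) 1 ×ˢ Ioo (0 : ℝ) 1 := by
    simp only [mem_prod, mem_Ioo]; norm_num
  obtain ⟨p₀, hp₀, hmax⟩ := isCompact_unitSquare.exists_isMaxOn ⟨_, Ioo_prod_subset_unitSquare hhalf⟩
    (continuousOn_base hz π hm1 hm)
  have hpos : 0 < base z π p₀ := (base_pos hz π hhalf).trans_le (hmax (Ioo_prod_subset_unitSquare hhalf))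
  obtain ⟨⟨hx0, hx1⟩, hy0, hy1⟩ := mem_unitSquare.1 hp₀
  -- the maximum point is interior (the base vanishes on the boundary)
  have hint : p₀ ∈ Ioo (0 : ℝ) 1 ×ˢ Ioo (0 : ℝ) 1 := by
    have hb : ¬ (p₀.1 = 0 ∨ p₀.1 = 1 ∨ p₀.2 = 0 ∨ p₀.2 = 1) := fun h =>
      hpos.ne' (base_eq_zero_of_boundary z π hh hj hk hl h)
    push Not at hb
    obtain ⟨h1, h2, h3, h4⟩ := hb
    exact ⟨⟨lt_of_le_of_ne hx0 (Ne.symm h1), lt_of_le_of_ne hx1 h2⟩,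
      lt_of_le_of_ne hy0 (Ne.symm h3), lt_of_le_of_ne hy1 h4⟩
  have hD₁ : 0 < denom₁ z p₀ := hint.1.1.trans_le (fst_le_denom₁ hz hp₀)
  have hwcont : ContinuousWithinAt (weight z) unitSquare p₀ :=
    (continuousAt_const.div (continuous_denom₁ z).continuousAt hD₁.ne').continuousWithinAt
  have hwpos : 0 < weight z p₀ := one_div_pos.2 hD₁
  have hfat : ∀ U : Set (ℝ × ℝ), IsOpen U → p₀ ∈ U → 0 < volume (U ∩ unitSquare) := fun U hU hpU =>
    Literature.Analysis.Asymptotics.measure_inter_pos_of_mem_interior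
      (Ioo_prod_subset_interior_unitSquare hint) hU hpU
  refine ⟨p₀, hint, hmax, hpos, ?_⟩
  exact Literature.Analysis.Asymptotics.tendsto_log_setIntegral_pow_mul_div_of_integrableOn
    isCompact_unitSquare measurableSet_unitSquare (continuousOn_base hz π hm1 hm) (integrableOn_weight hz)
    (fun p hp => base_nonneg hz π hp) (fun p hp => weight_nonneg hz hp) hp₀ hwcont hwpos
    (fun p hp => hmax hp) hpos hfat

/-- **`lim (1/n) log J_z^{(0)}(hn,…,qn) = (k−l−q) log z + log max g_z`** (`z ≥ 1`, `h, j, k, l ≥ 1`,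
`1 ≤ m ≤ j+k`) — the real-variable asymptotics of Viola–Zudilin's Proposition 4.1 in qualitative form (the
value of the maximum, e.g. `e^{−95.8085…}` for `z = 9`, `(37,37,22,14,23,8)`, is not computed here).
[cite: ViolaZudilin2018, Prop. 4.1 and (4.12)] -/
theorem exists_tendsto_log_J0_div {z : ℝ} (hz : 1 ≤ z) (π : Params) (hh : 1 ≤ π.h)
    (hj : 1 ≤ π.j) (hk : 1 ≤ π.k) (hl : 1 ≤ π.l) (hm1 : 1 ≤ π.m) (hm : π.m ≤ π.j + π.k) :
    ∃ p₀ ∈ Ioo (0 : ℝ) 1 ×ˢ Ioo (0 : ℝ) 1, IsMaxOn (base z π) unitSquare p₀ ∧ 0 < base z π p₀ ∧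
      Tendsto (fun n : ℕ => Real.log (J0 z π n) / n) atTop
        (𝓝 (((π.k : ℝ) - π.l - π.q) * Real.log z + Real.log (base z π p₀))) := by
  obtain ⟨p₀, hint, hmax, hpos, hlim⟩ := exists_isMaxOn_tendsto_log_integral_div hz π hh hj hk hl hm1 hm
  refine ⟨p₀, hint, hmax, hpos, ?_⟩
  have hp₀ : p₀ ∈ unitSquare := Ioo_prod_subset_unitSquare hint
  have hD₁ : 0 < denom₁ z p₀ := hint.1.1.trans_le (fst_le_denom₁ hz hp₀)
  -- the integrals are positive
  obtain ⟨C, hC, hCle⟩ :=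
    Literature.Analysis.Asymptotics.exists_pos_mul_pow_le_setIntegral_pow_mul_of_integrableOn
      isCompact_unitSquare measurableSet_unitSquare (continuousOn_base hz π hm1 hm) (integrableOn_weight hz)
      (fun p hp => base_nonneg hz π hp) (fun p hp => weight_nonneg hz hp) hp₀
      ((continuousAt_const.div (continuous_denom₁ z).continuousAt hD₁.ne').continuousWithinAt)
      (one_div_pos.2 hD₁)
      (fun U hU hpU => Literature.Analysis.Asymptotics.measure_inter_pos_of_mem_interior
        (Ioo_prod_subset_interior_unitSquare hint) hU hpU)
      (half_pos hpos) (half_lt_self hpos)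
  have hIpos : ∀ n : ℕ, 0 < ∫ p in unitSquare, base z π p ^ n * weight z p := fun n =>
    (mul_pos hC (pow_pos (half_pos hpos) n)).trans_le (hCle n)
  have hz0 : 0 < z := zero_lt_one.trans_le hz
  set c : ℝ := (π.k : ℝ) - π.l - π.q with hc
  have hlim2 := tendsto_const_nhds (x := c * Real.log z) |>.add hlim
  refine hlim2.congr' ?_
  filter_upwards [eventually_ge_atTop 1] with n hn
  have hn0 : (n : ℝ) ≠ 0 := by exact_mod_cast (show n ≠ 0 by omega)
  have hzpow : 0 < z ^ (((π.k : ℤ) - π.l - π.q) * n) := zpow_pos hz0 _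
  rw [J0, Real.log_mul hzpow.ne' (hIpos n).ne', Real.log_zpow]
  push_cast
  simp only [hc]
  field_simp

end ViolaZudilin

end Literature.NumberTheory.DiophantineApproximation

end
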